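import Summits.RiemannHypothesis.RiemannHypothesis.Theorems.RuelleBandExactFirstBandStubEvenComplexSector
import Literature.NumberTheory.LFunctions.WeilGroundEnergyParitySplit
import HarnessLib

/-!
# Stub `stub_realEvenSuffices` (REAL) of crux `OffLineParityDetection`, line `registered`

Route `WeilParity`, crux `Summit.RiemannHypothesis.RiemannHypothesis.Theses.WeilParity.OffLineParityDetection`
(item stmt-RiemannHypothesis-15431), line `registered`.  This file proves the registered stub
`stub_realEvenSuffices` BY NAME, with the registered signature: on any window `[-a, a]`, a lower
bound `x ≤ Re Q(e)` valid for every REAL-valued even `L²`-normalised Weil test `e` supported in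
`[-a, a]` is valid for every COMPLEX-valued even `L²`-normalised Weil test supported in `[-a, a]`
(`Q(g) = weilQuadratic g = W(g ⋆ g̃)`, `IsWeilTest g` = smooth of compact support).

## Proof

Write an even test `e = e₁ + i e₂` with `e₁ = Re e`, `e₂ = Im e`.  Both are even, real-valued test
functions (`stub_evenComplexSector_isWeilTest_re/_im`) supported in `tsupport e ⊆ [-a, a]`
(`tsupport_subset_Icc_of_symm`: they vanish wherever `e` does).  For a test function `h`,
`Q(h) = Q₀(h)` is the zero-side form (`WeilConverse.hasWeilZeroSide_zeroForm` and the PROVED explicit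
formula `explicit_formula_holds`, limits in `ℂ` being unique), and the zero-side form of an even test
splits, `Q₀(e) = Q₀(e₁) + Q₀(e₂)` (`stub_evenComplexSector_zeroForm`), so
`Re Q(e) = Re Q(e₁) + Re Q(e₂)`.  Pointwise `|e(t)|² = e₁(t)² + e₂(t)²`, so
`1 = ∫|e|² = N₁ + N₂` with `Nⱼ = ∫|eⱼ|²` (`IsWeilTest.integrable_norm_sq`).  HOMOGENEITY
(`stub_realEvenSuffices_mul_le`) turns the hypothesis — stated for normalised real even tests — into
`x · Nⱼ ≤ Re Q(eⱼ)`: if `Nⱼ = 0` then `eⱼ = 0` (`IsWeilTest.eq_zero_of_integral_norm_sq_eq_zero`) and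
`Q(0) = 0` (`weilQuadratic_zero`); if `Nⱼ > 0`, the test `c eⱼ` with `c = 1/√Nⱼ` is a real even
normalised test on the window and `Q(c g) = |c|² Q(g)` (`weilQuadratic_const_mul`).  Finally
`x = x (N₁ + N₂) ≤ Re Q(e₁) + Re Q(e₂) = Re Q(e)`.

References: E. Bombieri, *Remarks on Weil's quadratic functional in the theory of prime numbers I*,
Rend. Lincei (9) 11 (2000), 183–233, §3–§4 (`T[f * f̄*]` is a hermitian form); A. Weil, *Sur les
"formules explicites" de la théorie des nombres premiers* (1952).
-/

-- the problem directory `RiemannHypothesis/RiemannHypothesis` fixes the namespace (gate convention)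
set_option linter.dupNamespace false

noncomputable section

open Complex MeasureTheory Filter Set
open scoped Real Topology ComplexConjugate

namespace Summit.RiemannHypothesis.RiemannHypothesis.Theorems.WeilParityOffLineParityDetection

open Literature.NumberTheory.LFunctions
open Summit.RiemannHypothesis.RiemannHypothesis.Theorems.RuelleBandExactFirstBand

/-- **Homogeneous form of the real-even lower bound.** If `x ≤ Re Q(e)` for every real-valued even
`L²`-normalised test `e` on the window `[-a, a]`, then `x · ∫|g|² ≤ Re Q(g)` for every real-valued
even test `g` on the window: for `∫|g|² = 0`, `g = 0` and `Q(0) = 0`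
(`IsWeilTest.eq_zero_of_integral_norm_sq_eq_zero`, `weilQuadratic_zero`); otherwise normalise,
`c g` with `c = (∫|g|²)^{-1/2}` is again a real even test on the window and `Q(c g) = |c|² Q(g)`
(`weilQuadratic_const_mul`).  Pattern of `sInf_weilWindowSphereValues_mul_le_re`
(Bombieri 2000 §4 Problem 2: `λ = T[f * f̄*] / ‖f‖²`). [cite: Bombieri2000Weil, §4 Problem 2 (p. 193)] -/
theorem stub_realEvenSuffices_mul_le {a x : ℝ}
    (hB : ∀ e : ℝ → ℂ, IsWeilTest e → tsupport e ⊆ Set.Icc (-a) a → (∀ t, e (-t) = e t) →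
      (∀ t, (e t).im = 0) → ∫ t, ‖e t‖ ^ 2 = (1 : ℝ) → x ≤ (weilQuadratic e).re)
    {g : ℝ → ℂ} (hg : IsWeilTest g) (hsupp : tsupport g ⊆ Icc (-a) a)
    (hev : ∀ t, g (-t) = g t) (hre : ∀ t, (g t).im = 0) :
    x * ∫ t, ‖g t‖ ^ 2 ≤ (weilQuadratic g).re := by
  have hN2nn : 0 ≤ ∫ t : ℝ, ‖g t‖ ^ 2 := integral_nonneg fun _ ↦ by positivity
  rcases hN2nn.eq_or_lt with hz | hpos
  · have hg0 : g = 0 := hg.eq_zero_of_integral_norm_sq_eq_zero hz.symm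
    subst hg0
    rw [weilQuadratic_zero, Complex.zero_re, ← hz, mul_zero]
  · set N2 : ℝ := ∫ t : ℝ, ‖g t‖ ^ 2 with hN2
    set c : ℝ := (Real.sqrt N2)⁻¹ with hc
    have hcpos : 0 < c := inv_pos.2 (Real.sqrt_pos.2 hpos)
    have hnorm : ∫ t, ‖(c : ℂ) * g t‖ ^ 2 = (1 : ℝ) := by
      simp only [norm_mul, mul_pow, Complex.norm_real, Real.norm_of_nonneg hcpos.le]
      rw [integral_const_mul, hc, inv_pow, Real.sq_sqrt hN2nn, inv_mul_cancel₀ hpos.ne']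
    have hle : x ≤ (weilQuadratic fun t ↦ (c : ℂ) * g t).re :=
      hB _ (hg.const_mul c) (tsupport_mul_subset_right.trans hsupp)
        (fun t ↦ by simp only [hev t])
        (fun t ↦ by simp only [Complex.mul_im, Complex.ofReal_re, Complex.ofReal_im, hre t,
          mul_zero, zero_mul, add_zero])
        hnorm
    have hQ' : (weilQuadratic fun t ↦ (c : ℂ) * g t).re = c * c * (weilQuadratic g).re := by
      rw [weilQuadratic_const_mul, Complex.normSq_ofReal, Complex.re_ofReal_mul]
    have hcc : c * c * N2 = 1 := by
      rw [hc, ← mul_inv, Real.mul_self_sqrt hN2nn, inv_mul_cancel₀ hpos.ne']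
    have h1 : x * (c * c * N2) ≤ c * c * (weilQuadratic g).re := by
      rw [hcc, mul_one, ← hQ']
      exact hle
    have h2 : c * c * (x * N2) ≤ c * c * (weilQuadratic g).re := by
      linarith
    exact le_of_mul_le_mul_left h2 (mul_pos hcpos hcpos)

/-- **Stub `stub_realEvenSuffices` (REAL) of line `registered` — registered signature.**  On any
window, a lower bound `x` for `Re Q` valid on every REAL-valued even `L²`-normalised Weil test
supported in `[-a, a]` is valid on every (complex-valued) even normalised Weil test supported in
`[-a, a]`.  With `e₁ = Re e`, `e₂ = Im e` (even real tests on the same window,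
`stub_evenComplexSector_isWeilTest_re/_im`, `tsupport_subset_Icc_of_symm`):
`Q(e) = Q₀(e) = Q₀(e₁) + Q₀(e₂) = Q(e₁) + Q(e₂)` (`stub_evenComplexSector_zeroForm`; `Q₀(h) = Q(h)`
for a test `h` by `WeilConverse.hasWeilZeroSide_zeroForm`, the PROVED `explicit_formula_holds` and
uniqueness of limits), `1 = ∫|e|² = ∫|e₁|² + ∫|e₂|²` (pointwise `|z|² = (Re z)² + (Im z)²`), and the
homogeneous bound `x ∫|eⱼ|² ≤ Re Q(eⱼ)` (`stub_realEvenSuffices_mul_le`) sums to `x ≤ Re Q(e)`.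
For `a ≤ 0` both sides are vacuous. [cite: Bombieri2000Weil, §3–§4 (T[f * f̄*] hermitian); Weil1952] -/
theorem stub_realEvenSuffices :
    ∀ a x : ℝ,
      (∀ e : ℝ → ℂ, IsWeilTest e → tsupport e ⊆ Set.Icc (-a) a → (∀ t, e (-t) = e t) →
        (∀ t, (e t).im = 0) → ∫ t, ‖e t‖ ^ 2 = (1 : ℝ) → x ≤ (weilQuadratic e).re) →
      ∀ e : ℝ → ℂ, IsWeilTest e → tsupport e ⊆ Set.Icc (-a) a → (∀ t, e (-t) = e t) →
        ∫ t, ‖e t‖ ^ 2 = (1 : ℝ) → x ≤ (weilQuadratic e).re := by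
  intro a x hB e he hsupp heven hnorm
  have he1 := stub_evenComplexSector_isWeilTest_re he
  have he2 := stub_evenComplexSector_isWeilTest_im he
  have hs1 : tsupport (fun t : ℝ => (((e t).re : ℝ) : ℂ)) ⊆ Icc (-a) a :=
    tsupport_subset_Icc_of_symm hsupp fun s hs _ ↦ by
      simp only [hs, Complex.zero_re, Complex.ofReal_zero]
  have hs2 : tsupport (fun t : ℝ => (((e t).im : ℝ) : ℂ)) ⊆ Icc (-a) a :=
    tsupport_subset_Icc_of_symm hsupp fun s hs _ ↦ by
      simp only [hs, Complex.zero_im, Complex.ofReal_zero]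
  have h1 := stub_realEvenSuffices_mul_le hB he1 hs1 (fun t ↦ by simp only [heven t])
    (fun t ↦ Complex.ofReal_im _)
  have h2 := stub_realEvenSuffices_mul_le hB he2 hs2 (fun t ↦ by simp only [heven t])
    (fun t ↦ Complex.ofReal_im _)
  -- `Q₀(h) = Q(h)` for a test function `h`: both are the limit of the symmetric partial zero sums
  -- of `h ⋆ h̃` (`WeilConverse.hasWeilZeroSide_zeroForm` and the PROVED `explicit_formula_holds`)
  have hQW : ∀ {h : ℝ → ℂ}, IsWeilTest h → WeilConverse.zeroForm h = weilQuadratic h :=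
    fun hh ↦ tendsto_nhds_unique (WeilConverse.hasWeilZeroSide_zeroForm hh)
      (explicit_formula_holds (hh.weilConv hh.weilReflect))
  -- the `L²` norms split: `∫|e|² = ∫|e₁|² + ∫|e₂|²` (pointwise `|z|² = (Re z)² + (Im z)²`)
  have hN : ∫ t, ‖e t‖ ^ 2 =
      (∫ t, ‖(((e t).re : ℝ) : ℂ)‖ ^ 2) + ∫ t, ‖(((e t).im : ℝ) : ℂ)‖ ^ 2 := by
    rw [← integral_add he1.integrable_norm_sq he2.integrable_norm_sq]
    refine integral_congr_ae (Filter.Eventually.of_forall fun t ↦ ?_)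
    show ‖e t‖ ^ 2 = ‖(((e t).re : ℝ) : ℂ)‖ ^ 2 + ‖(((e t).im : ℝ) : ℂ)‖ ^ 2
    rw [Complex.norm_real, Complex.norm_real, Real.norm_eq_abs, Real.norm_eq_abs, sq_abs, sq_abs,
      Complex.sq_norm, Complex.normSq_apply]
    ring
  rw [← hQW he, stub_evenComplexSector_zeroForm he heven, Complex.add_re, hQW he1, hQW he2]
  calc x = x * ((∫ t, ‖(((e t).re : ℝ) : ℂ)‖ ^ 2) + ∫ t, ‖(((e t).im : ℝ) : ℂ)‖ ^ 2) := by
        rw [← hN, hnorm, mul_one]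
    _ ≤ (weilQuadratic fun t : ℝ => (((e t).re : ℝ) : ℂ)).re +
          (weilQuadratic fun t : ℝ => (((e t).im : ℝ) : ℂ)).re := by
        rw [mul_add]
        exact add_le_add h1 h2

end Summit.RiemannHypothesis.RiemannHypothesis.Theorems.WeilParityOffLineParityDetection

end
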